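import Summits.NavierStokesRegularity.NavierStokesRegularity.Theorems.LerayQuarterDissipationFiniteDissipationLiouvilleSliceLSixTools
import HarnessLib

/-!
# Route `LerayQuarterDissipation`, crux `FiniteDissipationLiouville` (stmt-NavierStokesRegularity-22144)
  — structure of the finite-dissipation stratum: every slice lies in `L⁶(ℝ³)` (file 2/2)

`--supports stmt-NavierStokesRegularity-22144` (helper). A Type-I ancient mild field `w` in the
KNSS gauge with Leray's quarter-rate dissipation law `∫‖∇w(s)‖² ≤ K/√(−s)` has, by Sobolev's
inequality, slices of the form `w(t) = c_t + g_t` with `g_t ∈ L⁶(ℝ³)` and a constant vector `c_t`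
(`Ḣ¹ ∩ L^∞ ⊂ L⁶ + constants`, tree `exists_const_sub_lsix_le`). This file proves that **the gauge
kills the constant**, `c_t = 0`:

  `w(t) ∈ L⁶(ℝ³)` and `(∫‖w(t)‖⁶)^{1/6} ≤ C_L √(K⁺/√(−t))` for every `t < 0`   (`memLp_six_slice`),

the structural fact ("`Ḣ¹ ⊂ L⁶` slices") used by the route, its critic and the crux's disprover
(e.g. to make ε-regularity legal on the stratum and to feed Chae–Wolf 2017 Thm 1.1 with `p = 6`
on its DSS members).

**Proof.** Apply the heat flow `e^{τΔ}` at the origin to the Oseen identity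
`w(t) = e^{(t−s)Δ}w(s) − B_s(w,w)(t)` (`s < t < 0 < τ`): `c + e^{τΔ}g(0) = e^{(τ+t−s)Δ}w(s)(0) −
e^{τΔ}[B_s(w,w)(t)](0)`; the caloric term is `≤ C/√(−s)` (Type I; the heat flow is an `L^∞`
contraction), the Duhamel term is `≤ (t−s)·Q·τ^{-3/4}` (file 1/2,
`norm_heatExtension_oseenDuhamel_le`: restart formula + the `L^∞ × L⁶` slice bound of the Oseen
kernel + Sobolev modulo constants slice by slice), and `|e^{τΔ}g(0)| ≤ τ^{-1/4}‖g‖₆` (file 1/2).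
Hence `‖c‖ ≤ C/√(−s) + (t−s)Qτ^{-3/4} + τ^{-1/4}‖g‖₆` for all `s < t`, `τ > 0`
(`norm_const_le_of_slice`); choosing `s` far in the past and then `τ` large gives `c = 0`.
Nothing here bears on Navier–Stokes regularity; no summit is proved.
-/

noncomputable section

open Set MeasureTheory Filter Topology Function Metric Real
open Literature.Analysis Literature.Analysis.FluidPDE Literature.Analysis.UnboundedOperators
open scoped ENNReal NNReal

namespace Summit.NavierStokesRegularity.NavierStokesRegularity.Theorems.FiniteDissipationLiouville.Birth

-- the problem-side namespace duplicates `NavierStokesRegularity` by design (summit = problem)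
set_option linter.dupNamespace false

section Slices

variable {C Kp C₆ CS : ℝ} {w : ℝ → EuclideanSpace ℝ (Fin 3) → EuclideanSpace ℝ (Fin 3)}

/-- **The key estimate.** With the data of `norm_heatExtension_oseenDuhamel_le`, a slice `w(t)`,
`t < 0`, differing from the constant `c` by the `L⁶` field `g = w(t) − c`, and any `s < t`,
`τ > 0`: `‖c‖ ≤ C/√(−s) + (t − s)·Q·τ^{-3/4} + τ^{-1/4}‖g‖₆` (heat flow of the Oseen identity
at the origin: semigroup law for the caloric part, the Duhamel lemma, and
`e^{τΔ}w(t) = e^{τΔ}g + c`). -/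
theorem norm_const_le_of_slice (hw : IsTypeIAncientMild C w) (hKp0 : 0 ≤ Kp) (hC₆ : 0 ≤ C₆)
    (hslice : ∀ {τ : ℝ}, 0 < τ → ∀ (x : EuclideanSpace ℝ (Fin 3))
      {f : EuclideanSpace ℝ (Fin 3) → EuclideanSpace ℝ (Fin 3)}, Continuous f →
      ∀ {A : ℝ}, (∀ y, ‖f y‖ ≤ A) → ∀ {c : EuclideanSpace ℝ (Fin 3)}, ‖c‖ ≤ A →
      MemLp (fun y => f y - c) 6 volume →
      ‖∫ y, oseenKernel τ (x - y) (f y) (f y)‖ ≤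
        C₆ * τ ^ (-(3 / 4 : ℝ)) * A * (∫ y, ‖f y - c‖ ^ (6 : ℝ)) ^ (1 / 6 : ℝ))
    (hCS : 0 ≤ CS)
    (hslab : ∀ σ < 0, ∃ c : EuclideanSpace ℝ (Fin 3), ‖c‖ ≤ C / Real.sqrt (-σ) ∧
      MemLp (fun y => w σ y - c) 6 volume ∧
      (∫ y, ‖w σ y - c‖ ^ (6 : ℝ)) ^ (1 / 6 : ℝ) ≤ CS * Real.sqrt (Kp / Real.sqrt (-σ)))
    {t : ℝ} (ht : t < 0) {c : EuclideanSpace ℝ (Fin 3)} (hcA : ‖c‖ ≤ C / Real.sqrt (-t))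
    (hmem : MemLp (fun y => w t y - c) 6 volume) {s τ : ℝ} (hst : s < t) (hτ : 0 < τ) :
    ‖c‖ ≤ C / Real.sqrt (-s) +
      (t - s) * (C₆ * (C / Real.sqrt (-t)) * (CS * Real.sqrt (Kp / Real.sqrt (-t))) *
        τ ^ (-(3 / 4 : ℝ))) +
      τ ^ (-(1 / 4 : ℝ)) * (∫ y, ‖w t y - c‖ ^ (6 : ℝ)) ^ (1 / 6 : ℝ) := by
  have hs0 : s < 0 := hst.trans ht
  have hC0 : 0 ≤ C := hw.nonneg
  set g : EuclideanSpace ℝ (Fin 3) → EuclideanSpace ℝ (Fin 3) := fun y => w t y - c with hgdef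
  have hgc : Continuous g := (hw.continuous_slice ht).sub continuous_const
  have hgb : ∀ y, ‖g y‖ ≤ 2 * (C / Real.sqrt (-t)) := fun y =>
    (norm_sub_le _ _).trans (by linarith [hw.norm_le ht y, hcA])
  -- the pieces of the Oseen identity at time `t`
  set H : EuclideanSpace ℝ (Fin 3) → EuclideanSpace ℝ (Fin 3) :=
    fun x => heatExtension (w s) (t - s) x with hH
  set Bd : EuclideanSpace ℝ (Fin 3) → EuclideanSpace ℝ (Fin 3) := oseenDuhamel 1 s w w t with hBd
  have hwt : w t = fun x => H x - Bd x := funext fun x => hw.mild_eq_heatExtension hst ht x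
  have hHb : ∀ x, ‖H x‖ ≤ C / Real.sqrt (-s) := fun x =>
    norm_heatExtension_le_of_bound (fun z => hw.norm_le hs0 z) (sub_pos.2 hst) x
  have hwsm : AEStronglyMeasurable (w s) volume := hw.aestronglyMeasurable_slice hs0
  have hwtm : AEStronglyMeasurable (w t) volume := hw.aestronglyMeasurable_slice ht
  have hBm : AEStronglyMeasurable Bd volume :=
    aestronglyMeasurable_oseenDuhamel one_pos (hw.aestronglyMeasurable_uncurry (s := s) ht.le)
      (hw.aestronglyMeasurable_uncurry (s := s) ht.le)
      (div_nonneg hC0 (Real.sqrt_nonneg _))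
      (fun σ hσ y => hw.norm_le_of_mem_Ioo ht hσ y) (fun σ hσ y => hw.norm_le_of_mem_Ioo ht hσ y)
      hst le_rfl
  have hHm : AEStronglyMeasurable H volume := by
    have hH' : H = fun x => w t x + Bd x := by
      funext x; rw [hwt]; simp
    rw [hH']
    exact hwtm.add hBm
  -- integrability of the convolution integrands at the origin
  have hIwt : Integrable (fun y => heatKernel τ y • w t (0 - y)) volume :=
    integrable_heatKernel_smul_sub_of_bound hwtm (fun y => hw.norm_le ht y) hτ 0
  have hIg : Integrable (fun y => heatKernel τ y • g (0 - y)) volume :=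
    integrable_heatKernel_smul_sub_of_bound hgc.aestronglyMeasurable hgb hτ 0
  have hIc : Integrable
      (fun y => heatKernel τ y • (fun _ : EuclideanSpace ℝ (Fin 3) => c) (0 - y)) volume :=
    integrable_heatKernel_smul_sub_of_bound aestronglyMeasurable_const (fun _ => le_rfl) hτ 0
  have hIH : Integrable (fun y => heatKernel τ y • H (0 - y)) volume :=
    integrable_heatKernel_smul_sub_of_bound hHm hHb hτ 0
  have hIB : Integrable (fun y => heatKernel τ y • Bd (0 - y)) volume := by
    refine (hIH.sub hIwt).congr (Eventually.of_forall fun y => ?_)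
    show heatKernel τ y • H (0 - y) - heatKernel τ y • w t (0 - y) = heatKernel τ y • Bd (0 - y)
    rw [hwt]
    simp only [smul_sub, sub_sub_cancel]
  -- (E1) heat flow of the Oseen identity; (E2) the caloric part is small
  have hE1 : heatExtension (w t) τ 0 = heatExtension H τ 0 - heatExtension Bd τ 0 := by
    rw [hwt]
    exact heatExtension_sub_apply_of_integrable hIH hIB
  have hE2 : ‖heatExtension H τ 0‖ ≤ C / Real.sqrt (-s) := by
    have hsemi : heatExtension H τ 0 = heatExtension (w s) (τ + (t - s)) 0 :=
      heatExtension_heatExtension_apply_of_integrable_heatKernel_mul_norm hwsm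
        (fun a ha => integrable_heatKernel_mul_norm_of_bound hwsm (fun y => hw.norm_le hs0 y) a ha)
        (sub_pos.2 hst) hτ 0
    rw [hsemi]
    exact norm_heatExtension_le_of_bound (fun z => hw.norm_le hs0 z)
      (by linarith [sub_pos.2 hst]) 0
  -- (E3) the Duhamel part
  have hE3 := norm_heatExtension_oseenDuhamel_le hw hKp0 hC₆ hslice hCS hslab hst ht hτ
  -- (E4) `e^{τΔ} w(t)(0) = e^{τΔ} g(0) + c`; (E5) `‖e^{τΔ} g(0)‖ ≤ τ^{-1/4} ‖g‖₆`
  have hE4 : heatExtension (w t) τ 0 = heatExtension g τ 0 + c := by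
    have hwt' : w t = fun y => g y + (fun _ : EuclideanSpace ℝ (Fin 3) => c) y := by
      funext y; simp [hgdef]
    rw [hwt', heatExtension_add_apply_of_integrable hIg hIc, heatExtension_const c hτ 0]
  have hE5 : ‖heatExtension g τ 0‖ ≤ τ ^ (-(1 / 4 : ℝ)) * (∫ y, ‖g y‖ ^ (6 : ℝ)) ^ (1 / 6 : ℝ) :=
    norm_heatExtension_le_rpow_mul_lsix hmem hτ 0
  -- combine
  have hc_eq : c = heatExtension H τ 0 - heatExtension Bd τ 0 - heatExtension g τ 0 := by
    rw [← hE1, hE4, add_sub_cancel_left]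
  calc ‖c‖ = ‖heatExtension H τ 0 - heatExtension Bd τ 0 - heatExtension g τ 0‖ := by
        rw [← hc_eq]
    _ ≤ ‖heatExtension H τ 0‖ + ‖heatExtension Bd τ 0‖ + ‖heatExtension g τ 0‖ :=
        (norm_sub_le _ _).trans (add_le_add (norm_sub_le _ _) le_rfl)
    _ ≤ _ := add_le_add (add_le_add hE2 hE3) hE5

end Slices

/-- **Every slice of a member of the finite-dissipation stratum lies in `L⁶(ℝ³)`**, with
`(∫ ‖w(t)‖⁶)^{1/6} ≤ C_L √(max K 0 / √(−t))` (statement and proof in the module docstring; the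
constant is the Sobolev-modulo-constants level of `exists_const_sub_lsix_le`, the point being that
the KNSS gauge forces the constant to vanish). -/
theorem memLp_six_slice :
    ∃ CL : ℝ, 0 < CL ∧ ∀ (C K : ℝ)
      (w : ℝ → EuclideanSpace ℝ (Fin 3) → EuclideanSpace ℝ (Fin 3)),
      Literature.Analysis.FluidPDE.IsTypeIAncientMild C w →
      (∀ s : ℝ, s < 0 → ∫⁻ x, ‖fderiv ℝ (w s) x‖ₑ ^ 2 ≤ ENNReal.ofReal (K / Real.sqrt (-s))) →
      ∀ t < 0, MemLp (w t) 6 volume ∧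
        (∫ x, ‖w t x‖ ^ (6 : ℝ)) ^ (1 / 6 : ℝ) ≤ CL * Real.sqrt (max K 0 / Real.sqrt (-t)) := by
  obtain ⟨C₆, hC₆, hslice⟩ := exists_norm_integral_oseenKernel_le_lsix
  obtain ⟨CS, hCS, hsob⟩ := exists_const_sub_lsix_le
  refine ⟨CS, hCS, ?_⟩
  intro C K w hw hDK t ht
  set Kp : ℝ := max K 0 with hKp
  have hKp0 : 0 ≤ Kp := le_max_right _ _
  have hD : ∀ s < 0, ∫⁻ x, ‖fderiv ℝ (w s) x‖ₑ ^ 2 ≤ ENNReal.ofReal (Kp / Real.sqrt (-s)) :=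
    fun s hs => (hDK s hs).trans
      (ENNReal.ofReal_le_ofReal (div_le_div_of_nonneg_right (le_max_left _ _) (Real.sqrt_nonneg _)))
  have hC0 : 0 ≤ C := hw.nonneg
  -- Sobolev modulo constants on every slice
  have hslab : ∀ σ < 0, ∃ c : EuclideanSpace ℝ (Fin 3), ‖c‖ ≤ C / Real.sqrt (-σ) ∧
      MemLp (fun y => w σ y - c) 6 volume ∧
      (∫ y, ‖w σ y - c‖ ^ (6 : ℝ)) ^ (1 / 6 : ℝ) ≤ CS * Real.sqrt (Kp / Real.sqrt (-σ)) := by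
    intro σ hσ
    have hf1 : ContDiff ℝ 1 (w σ) := (hw.contDiff_slice hσ).of_le (by exact_mod_cast le_top)
    exact hsob (w σ) hf1 _ (fun y => hw.norm_le hσ y) _ (by positivity) (hD σ hσ)
  obtain ⟨c, hcA, hmem, hN⟩ := hslab t ht
  -- ### the constant vanishes
  suffices hc : c = 0 by
    subst hc
    simp only [sub_zero] at hmem hN
    exact ⟨hmem, hN⟩
  by_contra hc0
  have hcpos : 0 < ‖c‖ := norm_pos_iff.2 hc0
  obtain ⟨P, hP⟩ : ∃ P : ℝ, P = (∫ y, ‖w t y - c‖ ^ (6 : ℝ)) ^ (1 / 6 : ℝ) := ⟨_, rfl⟩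
  have hP0 : 0 ≤ P := by
    rw [hP]; exact Real.rpow_nonneg (integral_nonneg fun y => by positivity) _
  obtain ⟨Q, hQ⟩ : ∃ Q : ℝ,
      Q = C₆ * (C / Real.sqrt (-t)) * (CS * Real.sqrt (Kp / Real.sqrt (-t))) := ⟨_, rfl⟩
  have hQ0 : 0 ≤ Q := by
    rw [hQ]
    exact mul_nonneg (mul_nonneg hC₆.le (div_nonneg hC0 (Real.sqrt_nonneg _)))
      (mul_nonneg hCS.le (Real.sqrt_nonneg _))
  have hkey : ∀ s < t, ∀ τ : ℝ, 0 < τ →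
      ‖c‖ ≤ C / Real.sqrt (-s) + (t - s) * (Q * τ ^ (-(3 / 4 : ℝ))) + τ ^ (-(1 / 4 : ℝ)) * P := by
    intro s hst τ hτ
    rw [hP, hQ]
    exact norm_const_le_of_slice hw hKp0 hC₆.le hslice hCS.le hslab ht hcA hmem hst hτ
  -- ### choice of `s`: the caloric part below `‖c‖/4`
  obtain ⟨R₀, hR₀⟩ : ∃ R₀ : ℝ, R₀ = 4 * C / ‖c‖ + 1 := ⟨_, rfl⟩
  have hR₀0 : 0 < R₀ := by rw [hR₀]; positivity
  obtain ⟨s, hs⟩ : ∃ s : ℝ, s = t - R₀ ^ 2 := ⟨_, rfl⟩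
  have hR2 : 0 < R₀ ^ 2 := pow_pos hR₀0 2
  have hst : s < t := by rw [hs]; linarith
  have hfirst : C / Real.sqrt (-s) ≤ ‖c‖ / 4 := by
    have hsR : R₀ ≤ Real.sqrt (-s) := by
      rw [show -s = R₀ ^ 2 + -t by rw [hs]; ring]
      calc R₀ = Real.sqrt (R₀ ^ 2) := (Real.sqrt_sq hR₀0.le).symm
        _ ≤ Real.sqrt (R₀ ^ 2 + -t) := Real.sqrt_le_sqrt (by linarith)
    have hCR : C / R₀ ≤ ‖c‖ / 4 := by
      rw [div_le_div_iff₀ hR₀0 (by norm_num : (0:ℝ) < 4), hR₀]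
      have e : ‖c‖ * (4 * C / ‖c‖ + 1) = 4 * C + ‖c‖ := by field_simp
      rw [e]
      linarith
    exact (div_le_div_of_nonneg_left hC0 hR₀0 hsR).trans hCR
  -- ### choice of `τ`: the two decaying parts below `‖c‖/4`
  have hts : 0 ≤ t - s := (sub_pos.2 hst).le
  obtain ⟨L, hL⟩ : ∃ L : ℝ, L = (t - s) * Q + P := ⟨_, rfl⟩
  have hL0 : 0 ≤ L := by rw [hL]; exact add_nonneg (mul_nonneg hts hQ0) hP0
  have hL1 : 0 < L + 1 := by linarith
  obtain ⟨a, ha⟩ : ∃ a : ℝ, a = max (4 * (L + 1) / ‖c‖) 1 := ⟨_, rfl⟩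
  have ha1 : 1 ≤ a := by rw [ha]; exact le_max_right _ _
  have ha0 : 0 < a := one_pos.trans_le ha1
  obtain ⟨τ, hτdef⟩ : ∃ τ : ℝ, τ = a ^ (4 : ℝ) := ⟨_, rfl⟩
  have hτ0 : 0 < τ := by rw [hτdef]; exact Real.rpow_pos_of_pos ha0 _
  have hτ1 : 1 ≤ τ := by rw [hτdef]; exact Real.one_le_rpow ha1 (by norm_num)
  have hτinv : τ ^ (-(1 / 4 : ℝ)) = a⁻¹ := by
    rw [hτdef, ← Real.rpow_mul ha0.le, show (4 : ℝ) * (-(1 / 4 : ℝ)) = -1 by norm_num,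
      Real.rpow_neg_one]
  have hainv : a⁻¹ ≤ ‖c‖ / (4 * (L + 1)) := by
    have h1 : 4 * (L + 1) / ‖c‖ ≤ a := by rw [ha]; exact le_max_left _ _
    have hpos : 0 < 4 * (L + 1) / ‖c‖ := by positivity
    calc a⁻¹ ≤ (4 * (L + 1) / ‖c‖)⁻¹ := (inv_le_inv₀ ha0 hpos).2 h1
      _ = ‖c‖ / (4 * (L + 1)) := by rw [inv_div]
  have h34 : τ ^ (-(3 / 4 : ℝ)) ≤ τ ^ (-(1 / 4 : ℝ)) :=
    Real.rpow_le_rpow_of_exponent_le hτ1 (by norm_num)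
  have hτq0 : 0 ≤ τ ^ (-(1 / 4 : ℝ)) := Real.rpow_nonneg hτ0.le _
  have hsecond : (t - s) * (Q * τ ^ (-(3 / 4 : ℝ))) + τ ^ (-(1 / 4 : ℝ)) * P ≤ ‖c‖ / 4 := by
    have e1 : (t - s) * (Q * τ ^ (-(3 / 4 : ℝ))) ≤ (t - s) * (Q * τ ^ (-(1 / 4 : ℝ))) :=
      mul_le_mul_of_nonneg_left (mul_le_mul_of_nonneg_left h34 hQ0) hts
    have e2 : (t - s) * (Q * τ ^ (-(1 / 4 : ℝ))) + τ ^ (-(1 / 4 : ℝ)) * P = L * τ ^ (-(1 / 4 : ℝ)) := by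
      rw [hL]; ring
    have e3 : L * τ ^ (-(1 / 4 : ℝ)) ≤ L * (‖c‖ / (4 * (L + 1))) := by
      rw [hτinv]; exact mul_le_mul_of_nonneg_left hainv hL0
    have e4 : L * (‖c‖ / (4 * (L + 1))) ≤ ‖c‖ / 4 := by
      rw [show L * (‖c‖ / (4 * (L + 1))) = (‖c‖ / 4) * (L / (L + 1)) by field_simp]
      refine mul_le_of_le_one_right (by positivity) ?_
      rw [div_le_one hL1]
      linarith
    linarith
  have hfin := hkey s hst τ hτ0
  linarith

end Summit.NavierStokesRegularity.NavierStokesRegularity.Theorems.FiniteDissipationLiouville.Birth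

end
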